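import Summits.Ventures.CertifiedManyBodySolver.Theorems.M3x2EdgeSplitSymReplayOutRouteEtaD
import Summits.Ventures.CertifiedManyBodySolver.Theorems.M3x2EdgeSplitSymReplaySideFactsWf
import HarnessLib

/-!
# SymReplay checker — WORD-LEVEL FACTOR ROWS («η»), part 3b: the LIST BRIDGE `shareRFastMFηD = shareRFastMFη` and the closing on the
ENGINE share «ηD» (dense integer word-level rows)

(team lb-sym, cell hub-lb; hub-lb-sym-eng-3 g4, on part 3a `…OutRouteEtaD` (ingredients), the pen's η spec `…OutRouteEta` /
`…OutRouteEtaSem` (hub-lb-sym-plan-1 g5) and hub-lb-sym-eng-4's `…OutRouteMFZ` / `…OutRouteMFD`; ADDITIVE, nothing landed is touched.)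

CONTENTS.  (f) `rowFastFηD_eq` (one dense word-level row = the spec row on lifted data: `bucketOf`/`bucketBy` buckets, `stepOpt_liftD`),
`colBoundR_eq` (engine width = `colBound (toGramBlock B)`), `blockEtaD_eq` (one block: rows lifted from their integerisation by
`rows_eq_lift`, `wflat_lift` / `tagRep_map`, `dgroup_lift_eq` on both sides), `shareRWithMFηD_eq`, **`shareRFastMFηD_eq : shareRFastMFηD …
= shareRFastMFη …`** under `liftOKR K` and `intCoefOK K gbs` (part 3a);  (g) the closings with `…PMF0`'s binder list:
**`energyDensity_ge_of_outroutePMFη0'`** = the landed η SPEC closing `…PMFη0` (part 2) WITHOUT its `hAsc` premise — redundant, since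
`hwf : wellFormed K.expand = true` already checks `rowAsc` on every R-row (`hAsc_of_wellFormed`, `…SideFactsWf`; finding and candidate
text hub-lb-sym-ref-2 g2, EtaSemWf.lean d103f96e254180f0) — and **`energyDensity_ge_of_outroutePMFηD0`** = the same on the ENGINE
share, hypotheses = `…PMF0`'s + `hC : intCoefOK K (K.gramR.map genBasis) = true` ONLY (`liftOKR K` holds for every certificate:
`liftOKR_all`, `…SideFactsWf`, hub-lb-sym-eng-4 g3 / hub-lb-sym-ref-2 g2).
MODULE GRAMMAR (E-class, hierarchical coarse routing): per module `m < J·L` one file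
`out_m : PackedNF.pisZero (PackedNF.pcanonNFZHBZ lo hi PackedNF.oracleV3 (PackedNF.encP lo hi (shareRFastMFηD momSpecC cert gbs tabC κ₂ J L
(m / L) (m % L)))) = true := by native_decide`; ONE new global `hC : intCoefOK cert (cert.gramR.map genBasis) = true` (`native_decide`,
once, next to `hcov`; rung V: true); close `energyDensity_ge_of_outroutePMFηD0 momSpecC cert hwf hRok PackedNF.oracleV3 tabC κ₂ J L hJ hL
lo hi hbox hcov hC hfacts`.  Standard axioms; no `native_decide` in this file.

PRICE (by value, hub-lb-sym-eng-3 g4 benches on the real rung-V certificate, interpreted): dots per module × 0.955 on rung V (no word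
sharing to exploit there), × 0.658 at E₁ (census kit j317218 = EBUDGET-600 rev 4 §11 rows «η+MFD»); per dot `ddot` 22 µs vs `sdot` 176 µs
at width 130; table build ≈ 4 s per module on rung V (sort 57 µs/item, accumulate ≈ 1 µs/row entry).

HONEST FRAMING: an interpreted replay-COST lever with its equality proofs; certifies nothing; no bound of record moves; tree floor
−0.8942613047 (rung V, computational) unchanged; #529 −0.8295699476 outside Lean; `LowerEdge_ge_m83o100` met BY VALUE only; no summit
or crux statement is proved here; nothing here predicts superconductivity.
-/

namespace Summit.Ventures.CertifiedManyBodySolver.Theorems.SymReplay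

open Literature.MathematicalPhysics.QuantumLattice
open Literature.MathematicalPhysics.QuantumLattice.HubbardWave0
open Literature.MathematicalPhysics.QuantumLattice.ThermodynamicLimit
open Literature.Probability.LatticeModels
open Literature.MathematicalPhysics.QuantumManyBody.StateRelaxation
open Summit.Ventures.CertifiedManyBodySolver.Theorems.WardSlot

section EtaDBridge

variable {M : Type} [DecidableEq M] [Hashable M]

/-! ##### (f) the list bridge: one row, one block, the R-part, the share -/

/-- **One dense word-level row = the spec row on lifted data.** -/
theorem rowFastFηD_eq (S : MomSpec M) (D : ℚ) (hD : D ≠ 0) (n : ℕ) (yD : List ℤ × (ℚ × Word)) (hy : yD.1.length = n)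
    (BD : List (List ℤ × (ℚ × Word))) (hB : ∀ x ∈ BD, x.1.length = n) (m s : ℚ) (T : List M) (P₂ : Word → Bool) :
    rowFastFη S (liftT D n yD) (bucketOf S (BD.map (liftT D n))) m s T P₂ =
      rowFastFηD S yD (bucketBy (fun x : List ℤ × (ℚ × Word) => mom S x.2.2) BD) (-1 * (m * s) / (D * D)) T P₂ := by
  unfold rowFastFη rowFastFηD
  refine List.flatMap_congr fun mt _ => ?_
  rw [bucketOf_getD, bucketBy_getD, List.filter_map, ← List.map_reverse, List.filterMap_map]
  have hf : ((fun x : List (ℚ × ℕ) × (ℚ × Word) => decide (mom S x.2.2 = S.sub mt (mom S (liftT D n yD).2.2))) ∘ liftT D n) =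
      fun x => decide (mom S x.2.2 = S.sub mt (mom S yD.2.2)) := rfl
  rw [hf]
  refine List.filterMap_congr fun x hx => ?_
  have hxn : x.1.length = n := hB x (List.mem_filter.1 (List.mem_reverse.1 hx)).1
  simp only [Function.comp_apply, liftT]
  rw [stepOpt_liftD D hD n yD.1 hy m s yD.2 x hxn]

omit [DecidableEq M] [Hashable M] in
/-- **The engine width IS the spec width** (`foldl max` against `foldr max`; the fold identity is folklore, cf.
`Literature.Computability.Complexity.CodeFP.foldl_max_eq_foldr`, kept local here to avoid that import). -/
theorem colBoundR_eq (B : GramBlockR) : colBoundR B = colBound (toGramBlock B) := by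
  have h : ∀ (l : List ℕ) (a : ℕ), l.foldl max a = max a (l.foldr max 0) := by
    intro l
    induction l with
    | nil => intro a; simp
    | cons x l ih => intro a; rw [List.foldl_cons, ih, List.foldr_cons, max_assoc]
  rw [colBoundR, colBound, h, Nat.zero_max]
  rfl

/-- The terms of `wflatZ` are basis terms. -/
theorem mem_wflatZ_term {qrz : List (QPoly × List (ℤ × ℕ))} {x : List (ℤ × ℕ) × (ℚ × Word)} (hx : x ∈ wflatZ qrz) :
    ∃ b ∈ qrz, x.2 ∈ b.1 := by
  simp only [wflatZ, List.mem_flatMap, List.mem_map] at hx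
  obtain ⟨b, hb, t', ht', rfl⟩ := hx
  exact ⟨b, hb, ht'⟩

/-- **One block: the dense enumeration = the spec enumeration** (rows lifted from their integerisation, integer coefficients). -/
theorem blockEtaD_eq (S : MomSpec M) (B : GramBlockR) (gb : List QPoly) (hDpos : 0 < blockDen B)
    (hlift : liftOK (blockDen B) B.rows = true) (hCr : ∀ p ∈ B.reps, ∀ t ∈ p, ((t.1.num : ℤ) : ℚ) = t.1)
    (hCb : ∀ q ∈ gb, ∀ t ∈ q, ((t.1.num : ℤ) : ℚ) = t.1) (T : List M) (P₂ : Word → Bool) :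
    ((dgroupD (colBoundR B) (tagRep (B.reps.zip (blockRowsZ B)))).flatMap fun y =>
      rowFastFηD S y (bucketBy (fun x : List ℤ × (ℚ × Word) => mom S x.2.2)
        (dgroupD (colBoundR B) (wflatZ (gb.zip (blockRowsZ B)))))
        (-1 * ((B.moves.length : ℚ) * B.scale) / (((blockDen B : ℕ) : ℚ) * ((blockDen B : ℕ) : ℚ))) T P₂) =
    (dgroup (colBound (toGramBlock B)) (tagRep (B.reps.zip B.rows))).flatMap fun y =>
      rowFastFη S y (bucketOf S (dgroup (colBound (toGramBlock B)) (wflat (gb.zip B.rows)))) B.moves.length B.scale T P₂ := by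
  have hD : ((blockDen B : ℕ) : ℚ) ≠ 0 := by exact_mod_cast hDpos.ne'
  have hrows : B.rows = (blockRowsZ B).map (liftRow ((blockDen B : ℕ) : ℚ)) := rows_eq_lift _ _ hlift
  have hIr : ∀ y ∈ tagRep (B.reps.zip (blockRowsZ B)), ((y.2.1.num : ℤ) : ℚ) = y.2.1 := fun y hy => by
    obtain ⟨a, ha, -, ht⟩ := tagRep_row hy
    rw [padj, List.mem_map] at ht
    obtain ⟨t, ht, hty⟩ := ht
    rw [← hty]
    exact hCr a.1 (List.of_mem_zip ha).1 t ht
  have hIb : ∀ x ∈ wflatZ (gb.zip (blockRowsZ B)), ((x.2.1.num : ℤ) : ℚ) = x.2.1 := fun x hx => by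
    obtain ⟨b, hb, ht'⟩ := mem_wflatZ_term hx
    exact hCb b.1 (List.of_mem_zip hb).1 x.2 ht'
  have hzip : ∀ (l : List (QPoly × List (ℤ × ℕ))), l.map (Prod.map id (liftRow ((blockDen B : ℕ) : ℚ))) =
      l.map fun b => (b.1, liftRow ((blockDen B : ℕ) : ℚ) b.2) :=
    fun l => List.map_congr_left fun b _ => by cases b; rfl
  rw [colBoundR_eq]
  conv_rhs => rw [hrows, List.zip_map_right, List.zip_map_right, hzip, hzip, wflat_lift, tagRep_map,
    dgroup_lift_eq _ _ _ hIr, dgroup_lift_eq _ _ _ hIb, flatMap_map']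
  refine List.flatMap_congr fun yD hyD => ?_
  exact (rowFastFηD_eq S _ hD _ yD (dgroupD_length hyD) _ (fun x hx => dgroupD_length hx) _ _ T P₂).symm

/-- **Dense η R-part = spec η R-part** under `liftOKR` and integer coefficients. -/
theorem shareRWithMFηD_eq (S : MomSpec M) (K : SymCertR) (hZ : liftOKR K = true) (gbs : List (List QPoly))
    (hC : intCoefOK K gbs = true) (T : List M) (P₂ : Word → Bool) :
    shareRWithMFηD S K gbs T P₂ = shareRWithMFη S K gbs T P₂ := by
  unfold shareRWithMFηD shareRWithMFη
  refine List.flatMap_congr fun Bg hBg => ?_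
  have hB : Bg.1 ∈ K.gramR := (List.of_mem_zip hBg).1
  have hG : Bg.2 ∈ gbs := (List.of_mem_zip hBg).2
  unfold liftOKR at hZ
  have hb := List.all_eq_true.1 hZ Bg.1 hB
  simp only [Bool.and_eq_true, decide_eq_true_eq] at hb
  unfold intCoefOK at hC
  simp only [Bool.and_eq_true, List.all_eq_true, isIntQ, decide_eq_true_eq] at hC
  exact blockEtaD_eq S Bg.1 Bg.2 hb.1 hb.2 (fun p hp t ht => hC.1 Bg.1 hB p hp t ht) (fun q hq t ht => hC.2 Bg.2 hG q hq t ht) T P₂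

/-- **THE BRIDGE: the dense-integer η share IS the spec η share** (list equality) — so `…OutRouteEtaSem`'s `hW`/`hsem`/closing apply. -/
theorem shareRFastMFηD_eq (S : MomSpec M) (K : SymCertR) (hZ : liftOKR K = true) (gbs : List (List QPoly))
    (hC : intCoefOK K gbs = true) (hm : MomTable M) (κ₂ : Word → ℕ) (J L i f : ℕ) :
    shareRFastMFηD S K gbs hm κ₂ J L i f = shareRFastMFη S K gbs hm κ₂ J L i f := by
  unfold shareRFastMFηD shareRFastMFη
  simp only [shareRWithMFηD_eq S K hZ gbs hC]

/-! ##### (g) the closings with `…PMF0`'s binder list (`hAsc` and `liftOKR` discharged by `…SideFactsWf`) -/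

/-- **η SPEC closing with `…PMF0`'s binder list exactly** (the landed `energyDensity_ge_of_outroutePMFη0` without `hAsc`, which
`hwf` implies — `hAsc_of_wellFormed`; hub-lb-sym-ref-2 g2): bare packed facts over `J·L` modules on
`m ↦ shareRFastMFη Sm K (K.gramR.map genBasis) hm κ₂ J L (m / L) (m % L)`. -/
theorem energyDensity_ge_of_outroutePMFη0' {Mo : Type} [DecidableEq Mo] [Hashable Mo] (Sm : MomSpec Mo) (K : SymCertR)
    (hwf : wellFormed K.expand = true) (hRok : K.gramR.all (gramBlockROK K.frame) = true)
    (oP : PackedNF.PWord → PackedNF.PHint) (hm : MomTable Mo) (κ₂ : Word → ℕ) (J L : ℕ) (hJ : 0 < J) (hL : 0 < L)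
    (lo hi : ℤ × ℤ) (hbox : boxLicence K.frame lo hi = true) (hcov : coverM Sm K (K.gramR.map genBasis) hm = true)
    (hfacts : OutFactsP0 lo hi oP (fun m => shareRFastMFη Sm K (K.gramR.map genBasis) hm κ₂ J L (m / L) (m % L)) 0 (J * L)) :
    ((symValueR K : ℚ) : ℝ) ≤ energyDensityTT' 1 0 8 (7 / 8) :=
  energyDensity_ge_of_outroutePMFη0 Sm K hwf hRok (hAsc_of_wellFormed K hwf) oP hm κ₂ J L hJ hL lo hi hbox hcov hfacts

/-- **Hierarchical routing, DENSE INTEGER word-level rows, bare packed facts (`J·L` modules)**: per module `m < J·L` one file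
`out_m : PackedNF.pisZero (PackedNF.pcanonNFZHBZ lo hi oP (PackedNF.encP lo hi (shareRFastMFηD Sm K (K.gramR.map genBasis) hm κ₂ J L
(m / L) (m % L)))) = true := by native_decide`; hypotheses = `…PMF0`'s + the ONE global side fact `hC : intCoefOK K gbs = true`
(`liftOKR K` by `liftOKR_all`, rows ascending by `hAsc_of_wellFormed`). -/
theorem energyDensity_ge_of_outroutePMFηD0 {Mo : Type} [DecidableEq Mo] [Hashable Mo] (Sm : MomSpec Mo) (K : SymCertR)
    (hwf : wellFormed K.expand = true) (hRok : K.gramR.all (gramBlockROK K.frame) = true)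
    (oP : PackedNF.PWord → PackedNF.PHint) (hm : MomTable Mo) (κ₂ : Word → ℕ) (J L : ℕ) (hJ : 0 < J) (hL : 0 < L)
    (lo hi : ℤ × ℤ) (hbox : boxLicence K.frame lo hi = true) (hcov : coverM Sm K (K.gramR.map genBasis) hm = true)
    (hC : intCoefOK K (K.gramR.map genBasis) = true)
    (hfacts : OutFactsP0 lo hi oP
      (fun m => shareRFastMFηD Sm K (K.gramR.map genBasis) hm κ₂ J L (m / L) (m % L)) 0 (J * L)) :
    ((symValueR K : ℚ) : ℝ) ≤ energyDensityTT' 1 0 8 (7 / 8) := by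
  have hS : (fun m => shareRFastMFηD Sm K (K.gramR.map genBasis) hm κ₂ J L (m / L) (m % L)) =
      fun m => shareRFastMFη Sm K (K.gramR.map genBasis) hm κ₂ J L (m / L) (m % L) := by
    funext m; exact shareRFastMFηD_eq Sm K (liftOKR_all K) _ hC hm κ₂ J L _ _
  rw [hS] at hfacts
  exact energyDensity_ge_of_outroutePMFη0' Sm K hwf hRok oP hm κ₂ J L hJ hL lo hi hbox hcov hfacts

end EtaDBridge

end Summit.Ventures.CertifiedManyBodySolver.Theorems.SymReplay
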